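import Mathlib
import Summits.KontsevichZagierPeriods.Zeta5Search.BrickTwistedHarmonicReduction
import Summits.KontsevichZagierPeriods.Zeta5Search.BrickDenominatorsOddC

/-!
# BrickDenominatorsAllC — Krattenthaler–Rivoal's THÉORÈME 1 (ii) for the symmetric very-well-poised bricks `r = 1`, `A` even,
and EVERY `C ≥ 0`, AT EVERY ODD PRIME: `v_p(2·d_n^{A+C−1}·p_{0,C,n}((−1)^A)) ≤ 1` (cell `pub-zeta5`, seat ct-1 g45)

HONEST FRAMING: systematic search; no irrationality claim unless certified.  INTEGRALITY (at odd primes) of the rational constant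
terms `p_{0,C,n}(1)` of the `C`-fold differentiated very-well-poised brick linear forms `Σ_{k≥1}(1/C!)R_n^{(C)}(k)`
(Krattenthaler–Rivoal, Mem. AMS **186** (2007) no. 875, §2.4 (eq:p0C), §3 Théorème 1 (ii); arXiv:math/0311114 p. 8) — a theorem
in print since 2007, reproduced here for `r = 1`, `A` even, EVERY `C ≥ 0`, at the ODD primes, by the cell's digit induction:
`p_{0,C,n}(1) = −(−1)^C·Σ_K Z^{(binom,C)}_K(n)` with the `C`-twisted harmonic cells
`Z^{(w,C)}_K(n) = Σ_s w_s·c_{K,s}(n)·H_K^{(s+C)}`, `w_s = binom(s+C−1, C)` (`BrickDenominatorsOddC.pZero_one_eq_twisted`), and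
PROPOSITION H^∞ for those cells (`BrickTwistedHarmonicReduction`).  This SUPERSEDES the parity restriction of
`BrickDenominatorsOddC.theoreme1_ii_odd_prime` (odd `C`, via the regular Taylor coefficients) at odd primes; the prime `2` for even
`C ≥ 2` is NOT in this file (odd `C` at `2`: `BrickDenominatorsOddCTwo`; `C = 0` at `2`: ct-1 g44's `BrickDenominatorsTwo`).  The named
fact `KrattenthalerRivoal2007.theoreme1` (all `A ≥ 2`, `r ≥ 0`) is NOT discharged.  Nothing about `ζ(5)`; no `γ` / record statement;
records in print UNMOVED.  Theorems only (0 `def`).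

* `padicValuation_natCast_choose_le` — binomial weights are `p`-integral;
* `pZero_one_eq_twist` — `p_{0,C,n}(1) = −(−1)^C Σ_KΣ_s binom(s+C−1,C)·(c_{K,s}·H_K^{(s+C)})`;
* **`theoreme1_ii_odd_prime_allC`** — `v_p(2·d_n^{A+C−1}·p_{0,C,n}((−1)^A)) ≤ 1` for every odd prime `p`, `A` even, `1 ≤ B`,
  `2B ≤ A`, EVERY `C`, every `n`, all data `c` of `R_{n,A,B,1}`; `padicValuation_lcmUpto_pow_mul_pZero_le` (without the `2`);
* `theoreme1_ii_den_two_pow_allC` — the denominator of `d_n^{A+C−1}·p_{0,C,n}((−1)^A)` is a power of `2`, every `C`.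
DATA (ct-1 g44's desk `alg/twistC.py`, exact): `2d_n^{A+C−1}p_{0,C,n}(1) ∈ ℤ` on `(4,1),(6,1),(6,2),(8,3)`, `C ≤ 3`, `n ≤ 16`,
odd-prime margins tight.
-/

namespace Summit.KontsevichZagierPeriods.Zeta5Search.BrickDenominatorsAllC

open Finset Nat WithZero
open Summit.KontsevichZagierPeriods.Zeta5Search.BrickLaurent (cell)
open Summit.KontsevichZagierPeriods.Zeta5Search.BrickHarmonicBlocks (hsum)
open Summit.KontsevichZagierPeriods.Zeta5Search.BrickDenominators (den_eq_two_pow_of_padicValuation_le)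
open Summit.KontsevichZagierPeriods.Zeta5Search.BrickDenominatorsOddC (pZero_one_eq_twisted)
open Summit.KontsevichZagierPeriods.Zeta5Search.BrickTwistedHarmonicReduction (padicValuation_lcmUpto_pow_mul_twist_le)
open Summit.KontsevichZagierPeriods.Zeta5Search.Zudilin2002IntegralityTwoAdic (padicValuation_intCast_le_one)
open Literature.NumberTheory.Irrationality.KrattenthalerRivoal2007 (IsPartialFractionData pZero)

noncomputable section

variable {p : ℕ} [Fact p.Prime]

/-- Binomial coefficients are `p`-integral. -/
theorem padicValuation_natCast_choose_le (a b : ℕ) : Rat.padicValuation p (Nat.choose a b : ℚ) ≤ 1 := by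
  exact_mod_cast padicValuation_intCast_le_one p (Nat.choose a b)

omit [Fact p.Prime] in
/-- `p_{0,C,n}(1) = −(−1)^C·Σ_{K≤n}Σ_{s∈[1,A]} binom(s+C−1, C)·(c_{K,s}(n)·H_K^{(s+C)})` — KR's constant term as a sum of `C`-twisted
harmonic cells (the shape of `BrickTwistedHarmonicReduction`). -/
theorem pZero_one_eq_twist {A B : ℕ} (hAB : 2 * B ≤ A) (hA1 : 1 < A) {n : ℕ} {c : ℕ → ℕ → ℚ}
    (hc : IsPartialFractionData n A B 1 c) (C : ℕ) :
    pZero n A C c 1 = -(-1) ^ C * ∑ K ∈ range (n + 1), ∑ s ∈ Icc 1 A,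
      (Nat.choose (s + C - 1) C : ℚ) * (cell A B 1 n K s * hsum (s + C) K) := by
  rw [pZero_one_eq_twisted hAB hA1 hc C]
  simp only [mul_assoc]

section odd

variable (hp2 : p ≠ 2) {A B : ℕ} (hA : Even A) (hB : 1 ≤ B) (hAB : 2 * B ≤ A)
include hp2 hA hB hAB

/-- **`d_n^{A+C−1}·p_{0,C,n}(1) ∈ ℤ_(p)`** for every odd prime `p`, EVERY `C`, every `n`, all data `c` of `R_{n,A,B,1}`
(`A` even, `1 ≤ B`, `2B ≤ A`) — at odd `p` the printed factor `2` is a unit. -/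
theorem padicValuation_lcmUpto_pow_mul_pZero_le (C : ℕ) {n : ℕ} {c : ℕ → ℕ → ℚ} (hc : IsPartialFractionData n A B 1 c) :
    Rat.padicValuation p (((Nat.lcmUpto n : ℕ) : ℚ) ^ (A + C - 1) * pZero n A C c 1) ≤ 1 := by
  rw [pZero_one_eq_twist hAB (by omega) hc C, mul_left_comm, map_mul, Valuation.map_neg, map_pow, Valuation.map_neg,
    Valuation.map_one, one_pow, one_mul]
  exact padicValuation_lcmUpto_pow_mul_twist_le hp2 hA hB hAB (fun s => padicValuation_natCast_choose_le _ _) n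

/-- **KRATTENTHALER–RIVOAL 2007, THÉORÈME 1 (ii), for `r = 1`, `A` even, `1 ≤ B`, `2B ≤ A` and EVERY `C ≥ 0`, AT AN ODD PRIME
`p`**: `v_p(2·d_n^{A+C−1}·p_{0,C,n}((−1)^A)) ≤ 1` for every `n` and all partial-fraction data `c` of `R_{n,A,B,1}`.  PROOF ROUTE ≠
PRINT: PROPOSITION H^∞ for the `C`-twisted harmonic cells with the constant weight.
[Krattenthaler–Rivoal, Mem. AMS 186 (2007) no. 875, §3 Théorème 1 (ii); arXiv:math/0311114 p. 8] -/
theorem theoreme1_ii_odd_prime_allC (C : ℕ) {n : ℕ} {c : ℕ → ℕ → ℚ} (hc : IsPartialFractionData n A B 1 c) :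
    Rat.padicValuation p (2 * ((Nat.lcmUpto n : ℕ) : ℚ) ^ (A + C - 1) * pZero n A C c ((-1) ^ A)) ≤ 1 := by
  rw [hA.neg_one_pow, mul_assoc, map_mul]
  exact mul_le_one' (by exact_mod_cast padicValuation_intCast_le_one p 2)
    (padicValuation_lcmUpto_pow_mul_pZero_le hp2 hA hB hAB C hc)

end odd

/-- **Across the odd primes**, every `C`: the denominator of `d_n^{A+C−1}·p_{0,C,n}((−1)^A)` is a power of `2`
(`A` even, `1 ≤ B`, `2B ≤ A`). -/
theorem theoreme1_ii_den_two_pow_allC {A B : ℕ} (hA : Even A) (hB : 1 ≤ B) (hAB : 2 * B ≤ A) (C : ℕ) {n : ℕ}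
    {c : ℕ → ℕ → ℚ} (hc : IsPartialFractionData n A B 1 c) :
    ∃ k : ℕ, (((Nat.lcmUpto n : ℕ) : ℚ) ^ (A + C - 1) * pZero n A C c ((-1) ^ A)).den = 2 ^ k := by
  refine den_eq_two_pow_of_padicValuation_le fun p hp hp2 => ?_
  have h := @padicValuation_lcmUpto_pow_mul_pZero_le p ⟨hp⟩ hp2 A B hA hB hAB C n c hc
  rwa [hA.neg_one_pow]

end

end Summit.KontsevichZagierPeriods.Zeta5Search.BrickDenominatorsAllC
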